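import Mathlib
import Summits.Ventures.PercRepro.TriangleCapPhiBound

/-!
# PercRepro — THE RESIDUE BOUND IN CLOSED FORM: `t (t − 1) + min(2 r (D − r), 2 min(r, D − r) + φ_D(2 r)) ≤ 2 j + 2 t (D − 1)`
(p3, gen 55; part 312)

The residue bound of part 301, `2 I + φ_D(t + I) + φ_D(t − I)`, minimised over the number `I ≤ t` of inside edges
(`r = t mod D`, `μ = min(r, D − r)`): at `I = 0` it is `2 φ_D(r) = 2 r (D − r)`; for `I ≥ μ` subadditivity gives
`φ(t + I) + φ(t − I) ≥ φ(2 t) = φ(2 r)` and `2 I ≥ 2 μ`; for `1 ≤ I < μ` both residues are in the open range, the value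
is `2 r (D − r) − 2 I (I − 1) ≥ 2 r (D − r) − 2 μ (μ − 1) = 2 μ + φ_D(2 r)` (`residue_min`).  THEOREM (`band_ge_residue_min`):
for every graph of the band with every off-degree `≤ D`,

  **`t (t − 1) + min(2 r (D − r), 2 min(r, D − r) + φ_D(2 r)) ≤ 2 j + 2 t (D − 1)`**

— the closed-form lower bound of the else regime, attained at `(ℓ, t, D) = (6, 22, 4)` (part 305: `4 < 8`) and
`(7, 32, 5)` (census), and equal to the bipartite value `2 r (D − r)` exactly when `μ ≤ 1` or `2 μ + φ_D(2 r) ≥ 2 r (D − r)`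
(so for `D ≤ 3` and for `r ∈ {0, 1, D − 1}`).  Axioms: standard.
-/

namespace PercRepro

namespace TriangleCap

namespace C047

open Finset

variable {V : Type*} [Fintype V] [DecidableEq V]

/-- `φ_D` depends on the residue: `φ_D(a) = φ_D(a mod D)`. -/
theorem phiD_mod (D a : ℕ) : phiD D a = phiD D (a % D) := by
  unfold phiD
  rw [Nat.mod_mod]

/-- `φ_D(2 t) = φ_D(2 (t mod D))`. -/
theorem phiD_two_mul_mod (D t : ℕ) : phiD D (2 * t) = phiD D (2 * (t % D)) := by
  unfold phiD
  rw [Nat.mul_mod, Nat.mul_mod 2 (t % D), Nat.mod_mod]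

/-- **THE RESIDUE MINIMUM:** for `I ≤ t`, `r = t mod D`, `μ = min(r, D − r)`:
`min(2 r (D − r), 2 μ + φ_D(2 r)) ≤ 2 I + φ_D(t + I) + φ_D(t − I)`. -/
theorem residue_min (D t I : ℕ) (hD : 0 < D) (hI : I ≤ t) :
    min (2 * ((t % D) * (D - t % D))) (2 * min (t % D) (D - t % D) + phiD D (2 * (t % D))) ≤
      2 * I + phiD D (t + I) + phiD D (t - I) := by
  set r := t % D with hr
  have hrD : r < D := Nat.mod_lt t hD
  rcases Nat.eq_zero_or_pos I with rfl | hI1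
  · -- `I = 0`: the value is `2 φ_D(t) = 2 r (D − r)`
    simp only [add_zero, Nat.sub_zero, mul_zero, zero_add]
    rw [phiD_mod D t, ← hr, phiD_of_lt D r hrD]
    have : 2 * (r * (D - r)) = r * (D - r) + r * (D - r) := by ring
    rw [this]
    exact le_trans (min_le_left _ _) (by omega)
  · rcases Nat.lt_or_ge I (min r (D - r)) with hlow | hhigh
    · -- `1 ≤ I < μ`: both residues in the open range
      have hIr : I < r := lt_of_lt_of_le hlow (min_le_left _ _)
      have hIDr : I < D - r := lt_of_lt_of_le hlow (min_le_right _ _)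
      have h1 : phiD D (t + I) = (r + I) * (D - r - I) := by
        rw [phiD_mod, Nat.add_mod, ← hr, Nat.mod_eq_of_lt (show I < D by omega),
          Nat.mod_eq_of_lt (show r + I < D by omega), phiD_of_lt D _ (by omega), Nat.sub_sub]
      have h2 : phiD D (t - I) = (r - I) * (D - r + I) := by
        have ht : t - I = D * (t / D) + (r - I) := by
          have := Nat.div_add_mod t D
          omega
        rw [phiD_mod, ht, Nat.mul_add_mod, Nat.mod_eq_of_lt (by omega : r - I < D), phiD_of_lt D _ (by omega)]
        congr 1
        omega
      rw [h1, h2]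
      apply le_trans (min_le_right _ _)
      -- `2 μ + φ(2r) ≤ 2 I + (r + I)(D − r − I) + (r − I)(D − r + I) = 2 I + 2 r (D − r) − 2 I²`
      rcases Nat.lt_or_ge (2 * r) D with h2r | h2r
      · rw [min_eq_left (by omega : r ≤ D - r), phiD_of_lt D _ h2r]
        have hsq : I * I ≤ I * (r - 1) := Nat.mul_le_mul_left I (by omega)
        have hpr := Nat.zero_le ((r - 1) * (r - I))
        zify [hIr.le, hIDr.le, (by omega : r ≤ D), (by omega : 2 * r ≤ D), (by omega : r + I ≤ D),
          (by omega : 1 ≤ r)] at hsq hpr ⊢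
        nlinarith [hsq, hpr, hI1]
      · rw [min_eq_right (by omega : D - r ≤ r)]
        have h2r' : phiD D (2 * r) = (2 * r - D) * (D - (2 * r - D)) := by
          unfold phiD
          rw [Nat.mod_eq_sub_mod h2r, Nat.mod_eq_of_lt (by omega)]
        rw [h2r']
        have hsq : I * I ≤ I * (D - r - 1) := Nat.mul_le_mul_left I (by omega)
        have hpr := Nat.zero_le ((D - r - 1) * (D - r - I))
        zify [hIr.le, hIDr.le, (by omega : r ≤ D), (by omega : D ≤ 2 * r), (by omega : 2 * r - D ≤ D),
          (by omega : r + I ≤ D), (by omega : r + 1 ≤ D), (by omega : 1 ≤ D - r)] at hsq hpr ⊢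
        nlinarith [hsq, hpr, hI1]
    · -- `I ≥ μ`: subadditivity `φ(t + I) + φ(t − I) ≥ φ(2 t) = φ(2 r)`
      have hsub : phiD D (2 * t) ≤ phiD D (t + I) + phiD D (t - I) := by
        have := phiD_add_le D (t + I) (t - I)
        have e : t + I + (t - I) = 2 * t := by omega
        rw [e] at this
        exact this
      rw [phiD_two_mul_mod, ← hr] at hsub
      apply le_trans (min_le_right _ _)
      omega

/-- **THE RESIDUE BOUND IN CLOSED FORM:** for every triangle-free `H` with `s` edges, `w` of degree `s − t ≥ 1`, every
off-degree `≤ D`, at the band value `2 j`, with `r = t mod D`: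
`t (t − 1) + min(2 r (D − r), 2 min(r, D − r) + φ_D(2 r)) ≤ 2 j + 2 t (D − 1)`. -/
theorem band_ge_residue_min (H : SimpleGraph V) [DecidableRel H.Adj] (hfree : H.CliqueFree 3) (s t j D : ℕ)
    (hs : H.edgeFinset.card = s) (w : V) (hw : deg H w + t = s) (hw1 : 1 ≤ deg H w)
    (hj : ∑ v, deg H v * deg H v + 2 * (t * (s - t - 1)) + 2 * j = s * (s + 1))
    (hD : ∀ v, offDeg H w v ≤ D) (hD0 : 0 < D) :
    t * (t - 1) + min (2 * ((t % D) * (D - t % D))) (2 * min (t % D) (D - t % D) + phiD D (2 * (t % D))) ≤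
      2 * j + 2 * (t * (D - 1)) := by
  have h := band_ge_phi H hfree s t j D hs w hw hw1 hj hD
  have hI : (insideEdges H w).card ≤ t := by
    have h1 := attach_add_card_inside H hfree w
    have h2 := card_offEdges_add_deg H w
    omega
  have hmin := residue_min D t (insideEdges H w).card hD0 hI
  omega

end C047

end TriangleCap

end PercRepro
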